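import Summits.MatrixMultiplication.OmegaCensus.STPP222IcosetCriterionDual
import Summits.MatrixMultiplication.OmegaCensus.STPP222IcosetWSearchSound
import Mathlib.Tactic.FinCases

/-!
# ω-census, icoset class at 2-rank four: from icoset data over `(ZMod 2)⁴ × H` to BIT SOLUTIONS with standard frame `0`

HONEST FRAMING (pub-omega census; verbatim): lottery ticket; floor = certified bounds/negative ranges.
Census STRUCTURE bookkeeping (Q7, the involution-coset class), nothing about `ω`.

The bridge between the abstract icoset criterion (`STPP222IcosetCriterion.lean`, `…CriterionDual.lean`: proper data `d` is STPP iff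
(T) every frame is `𝔽₂`-independent and (N) every non-constant zero-`h` triple has a functional killing its six slots with value `1`
on its offset) and the bit world of the kernel engine (`STPP222IcosetWSearch*.lean`): coordinates `encV : (ZMod 2)⁴ → [0,16)`
(additive-to-`xor`, injective), functionals as 4-bit numbers (`φ v = 1 ↔ ev u (encV v)`), hence a `BSol` whose frames are
independent and which rescues (`BSol.Resc`) every zero of `d` (`exists_bsol_of_data`); and the `GL₄(𝔽₂)` normal form: a kernel-
decided change of coordinates `gmap` sending frame `0` to `(1,2,4)` with its dual on witnesses (`gl_facts`), giving
**`exists_bsol_std`**: a bit solution with STANDARD frame `0` rescuing every zero of `d`.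
Seat pub-omega-kernel-l4 (gen 20), 2026-08-27.
-/

namespace Summit.MatrixMultiplication.OmegaCensus

namespace IcosetW

open IcosetH (getI allN allN_true)

/-- `𝔽₂⁴` as the census writes it. -/
abbrev V4 : Type := ZMod 2 × ZMod 2 × ZMod 2 × ZMod 2

/-! ## Coordinates -/

/-- Bit coordinates of a vector. -/
def encV (v : V4) : ℕ := v.1.val + 2 * v.2.1.val + 4 * v.2.2.1.val + 8 * v.2.2.2.val

/-- The vector with the given bits. -/
def ofBits (m : ℕ) : V4 :=
  (if Nat.testBit m 0 then 1 else 0, if Nat.testBit m 1 then 1 else 0, if Nat.testBit m 2 then 1 else 0,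
    if Nat.testBit m 3 then 1 else 0)

/-- The `𝔽₂`-dot product of a coefficient vector and a vector. -/
def dot (c v : V4) : ZMod 2 := c.1 * v.1 + c.2.1 * v.2.1 + c.2.2.1 * v.2.2.1 + c.2.2.2 * v.2.2.2

/-- `encV v < 16`. -/
theorem encV_lt (v : V4) : encV v < 16 := by
  unfold encV
  have h1 := ZMod.val_lt v.1; have h2 := ZMod.val_lt v.2.1; have h3 := ZMod.val_lt v.2.2.1; have h4 := ZMod.val_lt v.2.2.2
  omega

/-- Every vector is `ofBits` of its coordinates. -/
theorem ofBits_encV (v : V4) : ofBits (encV v) = v := by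
  obtain ⟨a, b, c, d⟩ := v
  fin_cases a <;> fin_cases b <;> fin_cases c <;> fin_cases d <;> rfl

/-- `encV` is injective. -/
theorem encV_injective {v w : V4} (h : encV v = encV w) : v = w := by
  rw [← ofBits_encV v, ← ofBits_encV w, h]

/-- `encV 0 = 0`. -/
theorem encV_zero : encV (0 : V4) = 0 := rfl

/-- Kernel evaluation of the finite facts: `ofBits` turns `xor` into `+`, `encV ∘ ofBits = id` below `16`, and the dot product of
`ofBits` vectors is the bit pairing `ev`. -/
theorem bits_check :
    (allN 16 fun m => allN 16 fun m' => decide (ofBits (Nat.xor m m') = ofBits m + ofBits m')) = true ∧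
    (allN 16 fun m => Nat.beq (encV (ofBits m)) m) = true ∧
    (allN 16 fun m => allN 16 fun m' => decide (dot (ofBits m) (ofBits m') = 1) == ev m m') = true := by
  refine ⟨?_, ?_, ?_⟩ <;> decide +kernel

/-- `encV` is additive-to-`xor`. -/
theorem encV_add (v w : V4) : encV (v + w) = Nat.xor (encV v) (encV w) := by
  have h := of_decide_eq_true (allN_true (allN_true bits_check.1 (encV_lt v)) (encV_lt w))
  rw [ofBits_encV, ofBits_encV] at h
  have h2 : encV (ofBits (Nat.xor (encV v) (encV w))) = Nat.xor (encV v) (encV w) :=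
    Nat.eq_of_beq_eq_true (allN_true bits_check.2.1 (Nat.xor_lt_two_pow (n := 4) (encV_lt v) (encV_lt w)))
  rw [← h2, h]

/-- The dot product is the bit pairing. -/
theorem dot_eq_one_iff (c v : V4) : dot c v = 1 ↔ ev (encV c) (encV v) = true := by
  have h := allN_true (allN_true bits_check.2.2 (encV_lt c)) (encV_lt v)
  rw [ofBits_encV, ofBits_encV] at h
  have h' := eq_of_beq h
  constructor
  · intro h1; rw [← h']; exact decide_eq_true h1
  · intro h1; rw [← h'] at h1; exact of_decide_eq_true h1

/-- A functional is the dot product with its values on the standard basis. -/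
theorem dual_eq_dot (φ : Module.Dual (ZMod 2) V4) (v : V4) :
    φ v = dot (φ (1,0,0,0), φ (0,1,0,0), φ (0,0,1,0), φ (0,0,0,1)) v := by
  have hv : v = v.1 • ((1,0,0,0) : V4) + v.2.1 • ((0,1,0,0) : V4) + v.2.2.1 • ((0,0,1,0) : V4) + v.2.2.2 • ((0,0,0,1) : V4) := by
    obtain ⟨a, b, c, d⟩ := v
    fin_cases a <;> fin_cases b <;> fin_cases c <;> fin_cases d <;> decide
  conv_lhs => rw [hv]
  simp only [map_add, map_smul, smul_eq_mul, dot]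
  ring

/-- The bit number of a functional. -/
noncomputable def uOf (φ : Module.Dual (ZMod 2) V4) : ℕ := encV (φ (1,0,0,0), φ (0,1,0,0), φ (0,0,1,0), φ (0,0,0,1))

/-- `φ v = 1 ↔ u(v) = 1` and `φ v = 0 ↔ u(v) = 0` in bits. -/
theorem uOf_spec (φ : Module.Dual (ZMod 2) V4) (v : V4) :
    (φ v = 1 ↔ ev (uOf φ) (encV v) = true) ∧ (φ v = 0 ↔ ev (uOf φ) (encV v) = false) := by
  have h1 : φ v = 1 ↔ ev (uOf φ) (encV v) = true := by rw [dual_eq_dot]; exact dot_eq_one_iff _ _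
  refine ⟨h1, ⟨fun h0 => ?_, fun h0 => ?_⟩⟩
  · cases e : ev (uOf φ) (encV v)
    · rfl
    · rw [h1.2 e] at h0; exact absurd h0 one_ne_zero
  · rcases Icoset.zmod2_cases (φ v) with h | h
    · exact h
    · rw [h1.1 h] at h0; exact absurd h0 (by decide)

/-! ## From data to a bit solution -/

section Data
variable {H : Type*} [AddCommGroup H] {K : ℕ} (d : Icoset.Data V4 H K)

/-- Extend a `Fin K`-indexed function to `ℕ` (junk `0` beyond `K`). -/
def ext (f : Fin K → V4) (t : ℕ) : ℕ := if h : t < K then encV (f ⟨t, h⟩) else 0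

/-- The bit solution of the data: frames in coordinates, offsets `p = xA + xB`, `q = xB + xC`. -/
noncomputable def bsolOf : BSol where
  sA := ext d.sA
  sB := ext d.sB
  sC := ext d.sC
  p := ext fun t => d.xA t + d.xB t
  q := ext fun t => d.xB t + d.xC t

omit [AddCommGroup H] in
/-- `ext` at an index below `K`. -/
theorem ext_of_lt (f : Fin K → V4) {t : ℕ} (ht : t < K) : ext f t = encV (f ⟨t, ht⟩) := dif_pos ht

omit [AddCommGroup H] in
/-- `ext` is below `16`. -/
theorem ext_lt (f : Fin K → V4) (t : ℕ) : ext f t < 16 := by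
  unfold ext; split_ifs
  · exact encV_lt _
  · norm_num

omit [AddCommGroup H] in
/-- The fields of `bsolOf`. -/
theorem bsolOf_fields : (bsolOf d).sA = ext d.sA ∧ (bsolOf d).sB = ext d.sB ∧ (bsolOf d).sC = ext d.sC ∧
    (bsolOf d).p = ext (fun t => d.xA t + d.xB t) ∧ (bsolOf d).q = ext (fun t => d.xB t + d.xC t) :=
  ⟨rfl, rfl, rfl, rfl, rfl⟩

omit [AddCommGroup H] in
/-- (T) gives independent bit frames. -/
theorem framesOk_bsolOf (hT : ∀ t, d.Indep t) : (bsolOf d).FramesOk K := by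
  intro t ht
  obtain ⟨e1, e2, e3, e4, e5⟩ := bsolOf_fields d
  rw [e1, e2, e3, e4, e5]
  refine ⟨ext_lt _ _, ext_lt _ _, ext_lt _ _, ext_lt _ _, ext_lt _ _, ?_⟩
  rw [ext_of_lt _ ht, ext_of_lt _ ht, ext_of_lt _ ht]
  set a := d.sA ⟨t, ht⟩; set b := d.sB ⟨t, ht⟩; set c := d.sC ⟨t, ht⟩
  have hI := hT ⟨t, ht⟩
  -- the seven non-trivial combinations are non-zero
  have nz : ∀ ε₁ ε₂ ε₃ : ZMod 2, ¬ (ε₁ = 0 ∧ ε₂ = 0 ∧ ε₃ = 0) → ε₁ • a + ε₂ • b + ε₃ • c ≠ 0 :=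
    fun ε₁ ε₂ ε₃ hne h0 => hne (hI ε₁ ε₂ ε₃ h0)
  have e : ∀ v : V4, encV v = 0 → v = 0 := fun v hv => encV_injective (hv.trans encV_zero.symm)
  unfold indepB
  simp only [Bool.and_eq_true, Bool.not_eq_true']
  refine ⟨⟨⟨⟨⟨⟨beq_false_of_ne fun h => nz 1 0 0 (by simp) ?_, beq_false_of_ne fun h => nz 0 1 0 (by simp) ?_⟩,
    beq_false_of_ne fun h => nz 0 0 1 (by simp) ?_⟩, beq_false_of_ne fun h => nz 1 1 0 (by simp) ?_⟩,
    beq_false_of_ne fun h => nz 1 0 1 (by simp) ?_⟩, beq_false_of_ne fun h => nz 0 1 1 (by simp) ?_⟩,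
    beq_false_of_ne fun h => nz 1 1 1 (by simp) ?_⟩
  · simpa using e a h
  · simpa using e b h
  · simpa using e c h
  · have : a = b := encV_injective h
    simp [this, Icoset.add_self_eq_zero]
  · have : a = c := encV_injective h
    simp [this, Icoset.add_self_eq_zero]
  · have : b = c := encV_injective h
    simp [this, Icoset.add_self_eq_zero]
  · rw [← encV_add, ← encV_add] at h
    simpa [add_assoc] using e _ h

omit [AddCommGroup H] in
/-- Decoding a zero code. -/
theorem z_fields (i j k : Fin K) (hK : K ≤ 8) : zi (64 * i.val + 8 * j.val + k.val) = i.val ∧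
    zj (64 * i.val + 8 * j.val + k.val) = j.val ∧ zk (64 * i.val + 8 * j.val + k.val) = k.val := by
  have h1 := i.2; have h2 := j.2; have h3 := k.2
  refine ⟨?_, ?_, ?_⟩
  · show (64 * i.val + 8 * j.val + k.val) / 64 = i.val; omega
  · show (64 * i.val + 8 * j.val + k.val) / 8 % 8 = j.val; omega
  · show (64 * i.val + 8 * j.val + k.val) % 8 = k.val; omega

omit [AddCommGroup H] in
/-- The offset identity `p_i + q_j + p_k + q_k = off(i,j,k)` in the module. -/
theorem off_eq (i j k : Fin K) :
    d.xA i + d.xB i + (d.xB j + d.xC j) + (d.xA k + d.xB k + (d.xB k + d.xC k)) = d.off i j k := by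
  have hkk := Icoset.add_self_eq_zero (d.xB k)
  have e : d.xA i + d.xB i + (d.xB j + d.xC j) + (d.xA k + d.xB k + (d.xB k + d.xC k)) =
      (d.xA i + d.xA k + d.xB i + d.xB j + d.xC j + d.xC k) + (d.xB k + d.xB k) := by abel
  rw [e, hkk, add_zero]; rfl

omit [AddCommGroup H] in
/-- (N) in witness form gives bit rescue of every zero. -/
theorem resc_bsolOf (hK : K ≤ 8) {i j k : Fin K}
    (hφ : ∃ φ : Module.Dual (ZMod 2) V4, (∀ r, φ (d.slots i j k r) = 0) ∧ φ (d.off i j k) = 1) :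
    (bsolOf d).Resc (64 * i.val + 8 * j.val + k.val) := by
  obtain ⟨φ, h0, h1⟩ := hφ
  obtain ⟨hi, hj, hk⟩ := z_fields i j k hK
  obtain ⟨e1, e2, e3, e4, e5⟩ := bsolOf_fields d
  have kill : ∀ r, ev (uOf φ) (encV (d.slots i j k r)) = false := fun r => ((uOf_spec φ _).2).1 (h0 r)
  have k0 := kill 0; have k1 := kill 1; have k2 := kill 2; have k3 := kill 3; have k4 := kill 4; have k5 := kill 5
  simp only [Icoset.Data.slots, Matrix.cons_val_zero, Matrix.cons_val_one, Matrix.cons_val] at k0 k1 k2 k3 k4 k5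
  have hu0 : uOf φ ≠ 0 := by
    intro hz
    have := ((uOf_spec φ (d.off i j k)).1).1 h1
    rw [hz] at this; exact absurd this (by unfold ev par4; simp)
  unfold BSol.Resc BSol.onL BSol.off
  rw [hi, hj, hk, e1, e2, e3, e4, e5, ext_of_lt _ i.2, ext_of_lt _ i.2, ext_of_lt _ i.2, ext_of_lt _ j.2, ext_of_lt _ j.2,
    ext_of_lt _ j.2, ext_of_lt _ k.2, ext_of_lt _ k.2, ext_of_lt _ k.2, ext_of_lt _ i.2, ext_of_lt _ j.2, ext_of_lt _ k.2,
    ext_of_lt _ k.2]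
  simp only [Fin.eta]
  refine ⟨uOf φ, encV_lt _, ?_, ?_, ?_, ?_⟩
  · unfold onLB kills; rw [beq_false_of_ne hu0, k0, k2]; rfl
  · unfold onLB kills; rw [beq_false_of_ne hu0, k3, k4]; rfl
  · unfold onLB kills; rw [beq_false_of_ne hu0, k1, k5]; rfl
  · rw [← encV_add, ← encV_add, ← encV_add, off_eq]; exact ((uOf_spec φ _).1).1 h1

end Data

/-! ## The `GL₄(𝔽₂)` normal form in bits -/

/-- The first functional `u` (largest) with prescribed values on `x, y, z`. -/
noncomputable def pickF (x y z : ℕ) (vx vy vz : Bool) : ℕ :=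
  @Nat.rec (fun _ => ℕ) 0 (fun u acc => cnd (ev (u + 1) x == vx && ev (u + 1) y == vy && ev (u + 1) z == vz) (u + 1) acc) 15

/-- The (largest) non-zero vector killed by the three functionals `f1 f2 f3`. -/
noncomputable def pickW (f1 f2 f3 : ℕ) : ℕ :=
  @Nat.rec (fun _ => ℕ) 0 (fun v acc => cnd (!(ev f1 (v + 1)) && !(ev f2 (v + 1)) && !(ev f3 (v + 1))) (v + 1) acc) 15

/-- Change of coordinates given the four new coordinate functionals. -/
noncomputable def gmapF (f1 f2 f3 f4 v : ℕ) : ℕ :=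
  cnd (ev f1 v) 1 0 + cnd (ev f2 v) 2 0 + cnd (ev f3 v) 4 0 + cnd (ev f4 v) 8 0

/-- The change of coordinates sending the frame `(x, y, z)` to `(1, 2, 4)`: evaluate the adapted dual basis. -/
noncomputable def gmap (x y z v : ℕ) : ℕ :=
  gmapF (pickF x y z true false false) (pickF x y z false true false) (pickF x y z false false true) (psiB x y z) v

/-- The dual change of coordinates on functionals: coefficients of `u` in the adapted dual basis. -/
noncomputable def gdual (x y z u : ℕ) : ℕ :=
  gmapF x y z (pickW (pickF x y z true false false) (pickF x y z false true false) (pickF x y z false false true)) u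

/-- Everything needed about the change of coordinates, as a kernel-decidable Boolean per frame (functionals computed once). -/
noncomputable def glCheck (x y z : ℕ) : Bool :=
  frc (pickF x y z true false false) fun f1 => frc (pickF x y z false true false) fun f2 =>
  frc (pickF x y z false false true) fun f3 => frc (psiB x y z) fun f4 => frc (pickW f1 f2 f3) fun w0 =>
  Nat.beq (gmapF f1 f2 f3 f4 x) 1 && Nat.beq (gmapF f1 f2 f3 f4 y) 2 && Nat.beq (gmapF f1 f2 f3 f4 z) 4 &&
  (allN 16 fun v => frc (gmapF f1 f2 f3 f4 v) fun gv =>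
    Nat.blt gv 16 && (Nat.beq v 0 || !(Nat.beq gv 0)) &&
    allN 16 fun w => Nat.beq (gmapF f1 f2 f3 f4 (Nat.xor v w)) (Nat.xor gv (gmapF f1 f2 f3 f4 w))) &&
  (allN 16 fun u => frc (gmapF x y z w0 u) fun du => Nat.beq u 0 || (Nat.blt du 16 && !(Nat.beq du 0) &&
    allN 16 fun v => ev du (gmapF f1 f2 f3 f4 v) == ev u v))

/-- `glCheck` restated with `gmap` / `gdual`. -/
theorem glCheck_eq (x y z : ℕ) : glCheck x y z =
    (Nat.beq (gmap x y z x) 1 && Nat.beq (gmap x y z y) 2 && Nat.beq (gmap x y z z) 4 &&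
    (allN 16 fun v => Nat.blt (gmap x y z v) 16 && (Nat.beq v 0 || !(Nat.beq (gmap x y z v) 0)) &&
      allN 16 fun w => Nat.beq (gmap x y z (Nat.xor v w)) (Nat.xor (gmap x y z v) (gmap x y z w))) &&
    (allN 16 fun u => Nat.beq u 0 || (Nat.blt (gdual x y z u) 16 && !(Nat.beq (gdual x y z u) 0) &&
      allN 16 fun v => ev (gdual x y z u) (gmap x y z v) == ev u v))) := by
  unfold glCheck gmap gdual; simp only [frc_eq]

/-- Kernel evaluation of `glCheck` over all independent frames. -/
theorem gl_check_all : (allN 16 fun x => allN 16 fun y => allN 16 fun z => !(indepB x y z) || glCheck x y z) = true := by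
  decide +kernel

/-- The change-of-coordinates facts for an independent frame. -/
theorem gl_facts {x y z : ℕ} (hx : x < 16) (hy : y < 16) (hz : z < 16) (hi : indepB x y z = true) :
    gmap x y z x = 1 ∧ gmap x y z y = 2 ∧ gmap x y z z = 4 ∧
    (∀ v, v < 16 → gmap x y z v < 16 ∧ (v ≠ 0 → gmap x y z v ≠ 0) ∧
      ∀ w, w < 16 → gmap x y z (Nat.xor v w) = Nat.xor (gmap x y z v) (gmap x y z w)) ∧
    (∀ u, u < 16 → u ≠ 0 → gdual x y z u < 16 ∧ gdual x y z u ≠ 0 ∧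
      ∀ v, v < 16 → ev (gdual x y z u) (gmap x y z v) = ev u v) := by
  have h := allN_true (allN_true (allN_true gl_check_all hx) hy) hz
  rw [hi] at h; simp only [Bool.not_true, Bool.false_or] at h
  rw [glCheck_eq] at h
  simp only [Bool.and_eq_true, Nat.beq_eq] at h
  obtain ⟨⟨⟨⟨h1, h2⟩, h3⟩, h4⟩, h5⟩ := h
  refine ⟨h1, h2, h3, fun v hv => ?_, fun u hu hu0 => ?_⟩
  · have hv' := allN_true h4 hv
    simp only [Bool.and_eq_true, Bool.or_eq_true, Nat.blt_eq, Nat.beq_eq, Bool.not_eq_true'] at hv'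
    obtain ⟨⟨hlt, hnz⟩, hadd⟩ := hv'
    refine ⟨hlt, fun hv0 => ?_, fun w hw => ?_⟩
    · rcases hnz with h | h
      · exact absurd h hv0
      · exact Nat.ne_of_beq_eq_false h
    · have := allN_true hadd hw; simpa using this
  · have hu' := allN_true h5 hu
    simp only [Bool.and_eq_true, Bool.or_eq_true, Nat.blt_eq, Nat.beq_eq, Bool.not_eq_true'] at hu'
    rcases hu' with h | ⟨⟨hlt, hnz⟩, hd⟩
    · exact absurd h hu0
    · exact ⟨hlt, Nat.ne_of_beq_eq_false hnz, fun v hv => eq_of_beq (allN_true hd hv)⟩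

namespace BSol

/-- Apply the change of coordinates of frame `0` to a bit solution. -/
noncomputable def std (S : BSol) : BSol where
  sA t := gmap (S.sA 0) (S.sB 0) (S.sC 0) (S.sA t)
  sB t := gmap (S.sA 0) (S.sB 0) (S.sC 0) (S.sB t)
  sC t := gmap (S.sA 0) (S.sB 0) (S.sC 0) (S.sC t)
  p t := gmap (S.sA 0) (S.sB 0) (S.sC 0) (S.p t)
  q t := gmap (S.sA 0) (S.sB 0) (S.sC 0) (S.q t)

/-- **Standard-frame normal form.**  The normalised solution has standard frame `0`, independent frames, and rescues every zero
the original rescues. -/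
theorem std_spec (S : BSol) {K : ℕ} (hK : 0 < K) (hF : S.FramesOk K) :
    (S.std.sA 0 = 1 ∧ S.std.sB 0 = 2 ∧ S.std.sC 0 = 4) ∧ S.std.FramesOk K ∧
      ∀ z, zi z < K → zj z < K → zk z < K → S.Resc z → S.std.Resc z := by
  obtain ⟨hx, hy, hz, -, -, hi⟩ := hF 0 hK
  obtain ⟨g1, g2, g3, gv, gd⟩ := gl_facts hx hy hz hi
  set x := S.sA 0; set y := S.sB 0; set zz := S.sC 0
  refine ⟨⟨g1, g2, g3⟩, fun t ht => ?_, fun z hi' hj' hk' ⟨u, hu, h0, h1, h2, hev⟩ => ?_⟩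
  · obtain ⟨ha, hb, hc, hp, hq, hI⟩ := hF t ht
    refine ⟨(gv _ ha).1, (gv _ hb).1, (gv _ hc).1, (gv _ hp).1, (gv _ hq).1, ?_⟩
    show indepB (gmap x y zz (S.sA t)) (gmap x y zz (S.sB t)) (gmap x y zz (S.sC t)) = true
    unfold indepB at hI ⊢
    simp only [Bool.and_eq_true, Bool.not_eq_true'] at hI ⊢
    obtain ⟨⟨⟨⟨⟨⟨n1, n2⟩, n3⟩, n4⟩, n5⟩, n6⟩, n7⟩ := hI
    have xself : ∀ a : ℕ, Nat.xor a a = 0 := fun a => Nat.xor_self a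
    have inj : ∀ v w, v < 16 → w < 16 → v ≠ w → gmap x y zz v ≠ gmap x y zz w := by
      intro v w hv hw hne heq
      have hvw : Nat.xor v w ≠ 0 := fun h0 => hne (Nat.eq_of_testBit_eq fun i => by
        have := congrArg (fun t => Nat.testBit t i) h0
        simp only [Nat.zero_testBit] at this
        have e : (v ^^^ w).testBit i = false := this
        rw [Nat.testBit_xor] at e
        cases hv' : v.testBit i <;> cases hw' : w.testBit i <;> simp_all)
      have := (gv (Nat.xor v w) (Nat.xor_lt_two_pow (n := 4) hv hw)).2.1 hvw
      rw [(gv _ hv).2.2 _ hw, heq, xself] at this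
      exact this rfl
    refine ⟨⟨⟨⟨⟨⟨beq_false_of_ne ((gv _ ha).2.1 (Nat.ne_of_beq_eq_false n1)),
      beq_false_of_ne ((gv _ hb).2.1 (Nat.ne_of_beq_eq_false n2))⟩,
      beq_false_of_ne ((gv _ hc).2.1 (Nat.ne_of_beq_eq_false n3))⟩,
      beq_false_of_ne (inj _ _ ha hb (Nat.ne_of_beq_eq_false n4))⟩,
      beq_false_of_ne (inj _ _ ha hc (Nat.ne_of_beq_eq_false n5))⟩,
      beq_false_of_ne (inj _ _ hb hc (Nat.ne_of_beq_eq_false n6))⟩, beq_false_of_ne ?_⟩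
    rw [← (gv _ ha).2.2 _ hb, ← (gv (Nat.xor (S.sA t) (S.sB t)) (Nat.xor_lt_two_pow (n := 4) ha hb)).2.2 _ hc]
    exact (gv (Nat.xor (Nat.xor (S.sA t) (S.sB t)) (S.sC t))
      (Nat.xor_lt_two_pow (n := 4) (Nat.xor_lt_two_pow (n := 4) ha hb) hc)).2.1 (Nat.ne_of_beq_eq_false n7)
  · have hu0 : u ≠ 0 := by
      unfold onL onLB at h0; simp only [Bool.and_eq_true, Bool.not_eq_true'] at h0; exact Nat.ne_of_beq_eq_false h0.1
    obtain ⟨dlt, dnz, dev⟩ := gd u hu hu0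
    have tr : ∀ X t, t < K → S.onL X t u = true → S.std.onL X t (gdual x y zz u) = true := by
      intro X t ht hon
      obtain ⟨ha, hb, hc, -, -, -⟩ := hF t ht
      unfold onL onLB kills at hon ⊢
      show (!(Nat.beq (gdual x y zz u) 0) && cnd (Nat.beq X 0) (!(ev _ (gmap x y zz (S.sA t))) && !(ev _ (gmap x y zz (S.sB t))))
        (cnd (Nat.beq X 1) (!(ev _ (gmap x y zz (S.sB t))) && !(ev _ (gmap x y zz (S.sC t))))
          (!(ev _ (gmap x y zz (S.sA t))) && !(ev _ (gmap x y zz (S.sC t)))))) = true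
      rw [dev _ ha, dev _ hb, dev _ hc, beq_false_of_ne dnz]
      rw [beq_false_of_ne hu0] at hon
      exact hon
    refine ⟨gdual x y zz u, dlt, tr 0 _ hi' h0, tr 1 _ hj' h1, tr 2 _ hk' h2, ?_⟩
    obtain ⟨-, -, -, hp1, hq1, -⟩ := hF _ hi'
    obtain ⟨-, -, -, hp2, hq2, -⟩ := hF _ hj'
    obtain ⟨-, -, -, hp3, hq3, -⟩ := hF _ hk'
    show ev (gdual x y zz u) (Nat.xor (Nat.xor (gmap x y zz (S.p (zi z))) (gmap x y zz (S.q (zj z))))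
      (Nat.xor (gmap x y zz (S.p (zk z))) (gmap x y zz (S.q (zk z))))) = true
    rw [← (gv _ hp1).2.2 _ hq2, ← (gv _ hp3).2.2 _ hq3,
      ← (gv (Nat.xor (S.p (zi z)) (S.q (zj z))) (Nat.xor_lt_two_pow (n := 4) hp1 hq2)).2.2
        (Nat.xor (S.p (zk z)) (S.q (zk z))) (Nat.xor_lt_two_pow (n := 4) hp3 hq3),
      dev (Nat.xor (Nat.xor (S.p (zi z)) (S.q (zj z))) (Nat.xor (S.p (zk z)) (S.q (zk z))))
        (Nat.xor_lt_two_pow (n := 4) (Nat.xor_lt_two_pow (n := 4) hp1 hq2) (Nat.xor_lt_two_pow (n := 4) hp3 hq3))]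
    exact hev

end BSol

/-- **From icoset data to a standard bit solution.**  Data over `(ZMod 2)⁴ × H` satisfying (T) and the witness form of (N)
yields a bit solution with independent frames, standard frame `0`, rescuing the code `64 i + 8 j + k` of every non-constant index
triple with `h(i,j,k) = 0`. -/
theorem exists_bsol_std {H : Type*} [AddCommGroup H] {K : ℕ} (hK : 0 < K) (hK8 : K ≤ 8) (d : Icoset.Data V4 H K)
    (hT : ∀ t, d.Indep t)
    (hN : ∀ i j k : Fin K, ¬ (i = j ∧ j = k) → d.h i j k = 0 →
      ∃ φ : Module.Dual (ZMod 2) V4, (∀ r, φ (d.slots i j k r) = 0) ∧ φ (d.off i j k) = 1) :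
    ∃ S : BSol, (S.sA 0 = 1 ∧ S.sB 0 = 2 ∧ S.sC 0 = 4) ∧ S.FramesOk K ∧
      ∀ i j k : Fin K, ¬ (i = j ∧ j = k) → d.h i j k = 0 → S.Resc (64 * i.val + 8 * j.val + k.val) := by
  have hF := framesOk_bsolOf d hT
  obtain ⟨h0, hF', hR⟩ := (bsolOf d).std_spec hK hF
  refine ⟨(bsolOf d).std, h0, hF', fun i j k hne hh => ?_⟩
  obtain ⟨hi, hj, hk⟩ := z_fields i j k hK8
  exact hR _ (by rw [hi]; exact i.2) (by rw [hj]; exact j.2) (by rw [hk]; exact k.2) (resc_bsolOf d hK8 (hN i j k hne hh))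

end IcosetW

end Summit.MatrixMultiplication.OmegaCensus
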